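import Summits.SmoothPoincare4.SmoothPoincare4.Theorems.SymplecticOrigamiGromovRecognitionRelEndSphereWedgeCountStableAux
import Summits.SmoothPoincare4.SmoothPoincare4.Theorems.SymplecticOrigamiGromovRecognitionRelEndHolCoordCompJHol
import Mathlib.Analysis.Complex.CauchyIntegral

/-!
# The intersection count of `JX`-spheres with a sphere at infinity is locally constant
(registered helper `helper_sphereWedgeCountStable` of line `cross-cap-laurent`, crux
`GromovRecognitionRelEnd`, item stmt-SmoothPoincare4-11009)

Setting.  `X` is a `C^∞` real `4`-manifold with tangent endomorphisms `JX`, `U ⊆ X` is open and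
`T : X → ℂ` is `C^∞` and `JX`-holomorphic on `U` (`dT (JX w) = i dT w`), with zero locus
`H∞ := {y ∈ U | T y = 0}` CLOSED in `X` — a holomorphic coordinate transverse to a sphere at
infinity of the wedge cap of the crux.  A two-chart sphere is a pair `u, v : ℂ → X` of `C^∞`
`JX`-holomorphic maps with `v w = u w⁻¹` (`w ≠ 0`); its chart expressions `f := T ∘ u`,
`g := T ∘ v = f ∘ (·)⁻¹` are holomorphic on the open sets `u ⁻¹' U`, `v ⁻¹' U`
(`helper_holCoordCompJHol`), and its intersection number with `H∞` is
`N := Σ_{z : u z ∈ H∞} ord_z f + [ord_0 g, if v 0 ∈ H∞]` (multiplicities `meromorphicOrderAt`,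
the point at infinity counted in the second chart).

Theorem `helper_sphereWedgeCountStable`.  For a family `(u s, v s)_{s ∈ S}` of two-chart
`JX`-spheres over a topological space `S`, jointly continuous in `(s, z)` together with the
`z`-derivatives of `T ∘ u s`, `T ∘ v s`, such that the sphere at `s₀` meets `H∞` in finitely many
parameters, `N(s) = N(s₀)` for all `s` near `s₀`.

Proof (Hurwitz's theorem in the two charts).  `twoChart_zeroCount_eventually_eq` is the abstract
form, for families `f g : S → ℂ → ℂ` with open domains `D, E ⊆ S × ℂ`, closed zero loci, and the
chart change `g s w = f s w⁻¹`.  Let `Z₀` be the finite zero set at `s₀`, bounded by `M`.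
1. Squares: `δ ∈ (0, 1]` with the closed squares `K_z` of half-side `δ` about the `z ∈ Z₀` inside
   the domain of `f_{s₀}`, far apart, each containing no other zero; `I := ⋃ R_z` (open
   squares); `r > 0` with `2rM < 1` and the square `K_∞ = [-r, r]²` about `w = 0` inside the
   domain of `g_{s₀}` if `0` is a zero of `g_{s₀}` there (case A; then `g_{s₀} ≠ 0` on
   `K_∞ ∖ {0}`, a zero `w ≠ 0` giving the zero `w⁻¹ ∈ Z₀` with `‖w⁻¹‖ > M`), and free of zeros of
   `g_{s₀}` in its domain otherwise (case B).  (Auxiliary file `…SphereWedgeCountStableAux`.)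
2. Persistence for `s` near `s₀` (generalised tube lemma): the `K_z` stay in the domain of `f_s`,
   no zero of `f_s` lies in the compact set `{‖z‖ ≤ r⁻¹} ∖ I` (closed zero locus), `K_∞` stays in
   the domain of `g_s` (A) / free of zeros (B); and, by `helper_zeroCountStable` restricted to a
   neighbourhood of `s₀` (`zeroCountStable_nhds`), `f_s ≠ 0` on `∂K_z` with the same zero count
   in `R_z` as `f_{s₀}`, likewise for `g_s` on `K_∞` in case A.
3. Counting at such an `s` (in particular at `s₀`): the zeros of `f_s` split into those in the
   disjoint `R_z` and the far ones, which correspond under `z ↦ z⁻¹`, with equal multiplicity,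
   to the zeros `w ≠ 0` of `g_s` in `R_∞` (`zeroCount_near_decomp`,
   `helper_twoChartFarZeroCount`, `zeroCount_far_decomp_off`); hence
   `N(s) = Σ_{z ∈ Z₀} count_{R_z}(f_s) + count_{R_∞}(g_s)` (A), resp. `Σ_{z ∈ Z₀} count_{R_z}(f_s)`
   (B), and these agree at `s` and `s₀` by step 2.

References: D. McDuff, D. Salamon, *J-holomorphic Curves and Symplectic Topology*, 2nd ed., AMS
Colloquium Publications 52 (2012), §2.6 and Appendix E (intersection numbers of `J`-holomorphic
curves are local and deformation invariant); M. Gromov, *Pseudo holomorphic curves in symplectic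
manifolds*, Invent. Math. 82 (1985), 2.4.A1'; Hurwitz's theorem (folklore complex analysis).
No definitions, notation or instances.
-/

noncomputable section

open Complex Set Filter Topology Metric
open scoped Manifold ContDiff

-- the prescribed namespace `Summit.<P>.<Sub>.…` duplicates `SmoothPoincare4` (P = Sub)
set_option linter.dupNamespace false

namespace Summit.SmoothPoincare4.SmoothPoincare4.Theorems.GromovRecognitionRelEnd.CrossCapLaurent

/-- **Tube lemma, open form.** If the compact set `K` satisfies `{s₀} × K ⊆ D` for an open
`D ⊆ S × ℂ`, then `{s} × K ⊆ D` for all `s` near `s₀`. -/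
theorem eventually_forall_mem_of_isCompact_isOpen {S : Type} [TopologicalSpace S] {K : Set ℂ}
    (hK : IsCompact K) {D : Set (S × ℂ)} (hD : IsOpen D) {s₀ : S} (h : ∀ z ∈ K, (s₀, z) ∈ D) :
    ∀ᶠ s in 𝓝 s₀, ∀ z ∈ K, (s, z) ∈ D :=
  hK.eventually_forall_of_forall_eventually (P := fun s z => (s, z) ∈ D) fun z hz => by
    filter_upwards [hD.mem_nhds (h z hz)] with q hq
    simpa only [Prod.mk.eta] using hq

/-- **Tube lemma, closed form.** If the compact set `K` satisfies `({s₀} × K) ∩ A = ∅` for a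
closed `A ⊆ S × ℂ`, then `({s} × K) ∩ A = ∅` for all `s` near `s₀`. -/
theorem eventually_forall_notMem_of_isCompact_isClosed {S : Type} [TopologicalSpace S]
    {K : Set ℂ} (hK : IsCompact K) {A : Set (S × ℂ)} (hA : IsClosed A) {s₀ : S}
    (h : ∀ z ∈ K, (s₀, z) ∉ A) : ∀ᶠ s in 𝓝 s₀, ∀ z ∈ K, (s, z) ∉ A :=
  eventually_forall_mem_of_isCompact_isOpen hK hA.isOpen_compl h

/-- **Local zero-count stability** (neighbourhood version of `helper_zeroCountStable`).
If `F s` is analytic at the points `z` with `(s, z) ∈ D`, `F` and its `z`-derivative are jointly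
continuous on `D`, `{s} × K ⊆ D` for all `s` in a neighbourhood of `s₀` (`K` a closed rectangle)
and `F s₀` has no zero on `∂K`, then for `s` near `s₀` the same holds for `F s` and its number of
zeros in the open rectangle, counted with multiplicity, equals that of `F s₀`. -/
theorem zeroCountStable_nhds {S : Type} [TopologicalSpace S] {F : S → ℂ → ℂ} {D : Set (S × ℂ)}
    {a b c d : ℝ} {s₀ : S} (hab : a < b) (hcd : c < d)
    (hN : {s : S | ∀ z ∈ Icc a b ×ℂ Icc c d, (s, z) ∈ D} ∈ 𝓝 s₀)
    (hF : ∀ q ∈ D, AnalyticAt ℂ (F q.1) q.2)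
    (hFc : ContinuousOn (fun q : S × ℂ => F q.1 q.2) D)
    (hFd : ContinuousOn (fun q : S × ℂ => deriv (F q.1) q.2) D)
    (hbd : ∀ z ∈ Icc a b ×ℂ Icc c d, z ∉ Ioo a b ×ℂ Ioo c d → F s₀ z ≠ 0) :
    ∀ᶠ s in 𝓝 s₀, (∀ z ∈ Icc a b ×ℂ Icc c d, z ∉ Ioo a b ×ℂ Ioo c d → F s z ≠ 0) ∧
      ∑ᶠ ρ ∈ {ρ : ℂ | F s ρ = 0 ∧ ρ ∈ Ioo a b ×ℂ Ioo c d}, (meromorphicOrderAt (F s) ρ).untop₀ =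
      ∑ᶠ ρ ∈ {ρ : ℂ | F s₀ ρ = 0 ∧ ρ ∈ Ioo a b ×ℂ Ioo c d},
        (meromorphicOrderAt (F s₀) ρ).untop₀ := by
  set N : Set S := {s : S | ∀ z ∈ Icc a b ×ℂ Icc c d, (s, z) ∈ D} with hN_def
  have hs₀N : s₀ ∈ N := mem_of_mem_nhds hN
  -- the family restricted to the subtype `N` of parameters
  have hmaps : MapsTo (fun q : N × ℂ => ((q.1 : S), q.2)) (univ ×ˢ (Icc a b ×ℂ Icc c d)) D :=
    fun q hq => q.1.2 q.2 hq.2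
  have hcont : Continuous (fun q : N × ℂ => ((q.1 : S), q.2)) := by fun_prop
  have h := helper_zeroCountStable N (fun s' => F s') a b c d ⟨s₀, hs₀N⟩ hab hcd
    (fun s' z hz => hF (s'.1, z) (s'.2 z hz))
    (hFc.comp hcont.continuousOn hmaps) (hFd.comp hcont.continuousOn hmaps) hbd
  have h' : ∀ᶠ s in map ((↑) : N → S) (𝓝 ⟨s₀, hs₀N⟩), (∀ z ∈ Icc a b ×ℂ Icc c d,
      z ∉ Ioo a b ×ℂ Ioo c d → F s z ≠ 0) ∧
      ∑ᶠ ρ ∈ {ρ : ℂ | F s ρ = 0 ∧ ρ ∈ Ioo a b ×ℂ Ioo c d}, (meromorphicOrderAt (F s) ρ).untop₀ =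
      ∑ᶠ ρ ∈ {ρ : ℂ | F s₀ ρ = 0 ∧ ρ ∈ Ioo a b ×ℂ Ioo c d},
        (meromorphicOrderAt (F s₀) ρ).untop₀ := by
    rw [eventually_map]
    exact h
  rwa [map_nhds_subtype_coe_eq_nhds hs₀N hN] at h'

/-- **Two-chart zero count is locally constant** (abstract form of
`helper_sphereWedgeCountStable`). Let `f g : S → ℂ → ℂ` be families over a topological space
`S` with open domains `D, E ⊆ S × ℂ`, analytic in the second variable at the points of the
domains, jointly continuous there together with their `z`-derivatives, with CLOSED zero loci
`{q ∈ D | f q = 0}`, `{q ∈ E | g q = 0}` in `S × ℂ`, and related by the chart change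
`g s w = f s w⁻¹`, `(s, w) ∈ E ↔ (s, w⁻¹) ∈ D` for `w ≠ 0`. If the zero set of `f s₀` in `D_{s₀}`
is finite, then the total multiplicity of the zeros of `f s` in `D_s` plus the multiplicity of
`g s` at `w = 0` (when `0` is a zero in `E_s`) is constant for `s` near `s₀`. -/
theorem twoChart_zeroCount_eventually_eq {S : Type} [TopologicalSpace S] {f g : S → ℂ → ℂ}
    {D E : Set (S × ℂ)} {s₀ : S} (hD : IsOpen D) (hE : IsOpen E)
    (hA : IsClosed {q : S × ℂ | q ∈ D ∧ f q.1 q.2 = 0})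
    (hB : IsClosed {q : S × ℂ | q ∈ E ∧ g q.1 q.2 = 0})
    (hfa : ∀ q ∈ D, AnalyticAt ℂ (f q.1) q.2) (hga : ∀ q ∈ E, AnalyticAt ℂ (g q.1) q.2)
    (hfc : ContinuousOn (fun q : S × ℂ => f q.1 q.2) D)
    (hgc : ContinuousOn (fun q : S × ℂ => g q.1 q.2) E)
    (hfd : ContinuousOn (fun q : S × ℂ => deriv (f q.1) q.2) D)
    (hgd : ContinuousOn (fun q : S × ℂ => deriv (g q.1) q.2) E)
    (hED : ∀ (s : S) (w : ℂ), w ≠ 0 → ((s, w) ∈ E ↔ (s, w⁻¹) ∈ D))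
    (hgf : ∀ (s : S) (w : ℂ), w ≠ 0 → g s w = f s w⁻¹)
    (hfin : {z : ℂ | (s₀, z) ∈ D ∧ f s₀ z = 0}.Finite) :
    ∀ᶠ s in 𝓝 s₀,
      (∑ᶠ z ∈ {z : ℂ | (s, z) ∈ D ∧ f s z = 0}, (meromorphicOrderAt (f s) z).untop₀) +
        (∑ᶠ w ∈ {w : ℂ | w = 0 ∧ (s, w) ∈ E ∧ g s w = 0}, (meromorphicOrderAt (g s) w).untop₀) =
      (∑ᶠ z ∈ {z : ℂ | (s₀, z) ∈ D ∧ f s₀ z = 0}, (meromorphicOrderAt (f s₀) z).untop₀) +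
        (∑ᶠ w ∈ {w : ℂ | w = 0 ∧ (s₀, w) ∈ E ∧ g s₀ w = 0},
          (meromorphicOrderAt (g s₀) w).untop₀) := by
  -- the finite zero set at `s₀` and a bound for it
  set Z₀ : Set ℂ := {z : ℂ | (s₀, z) ∈ D ∧ f s₀ z = 0} with hZ₀_def
  obtain ⟨M, hM, hZM⟩ : ∃ M : ℝ, 0 < M ∧ ∀ z ∈ Z₀, ‖z‖ + 2 < M := by
    obtain ⟨B, hB⟩ := (hfin.image fun z => ‖z‖).bddAbove
    refine ⟨|B| + 3, by positivity, fun z hz => ?_⟩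
    have h := hB (mem_image_of_mem (fun z => ‖z‖) hz)
    linarith [le_abs_self B]
  -- slices at `s₀`
  have hDs₀ : IsOpen {w : ℂ | (s₀, w) ∈ D} := hD.preimage (Continuous.prodMk_right s₀)
  have hEs₀ : IsOpen {w : ℂ | (s₀, w) ∈ E} := hE.preimage (Continuous.prodMk_right s₀)
  have hBs₀ : IsClosed {w : ℂ | (s₀, w) ∈ E ∧ g s₀ w = 0} :=
    hB.preimage (Continuous.prodMk_right s₀)
  -- Step 1: the squares around the points of `Z₀` …
  obtain ⟨δ, hδ, hδ1, hδO, hδsep⟩ := exists_halfSide_squares hDs₀ hfin (fun z hz => hz.1)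
  have hKD : ∀ z ∈ Z₀, ∀ w ∈ Icc (z.re - δ) (z.re + δ) ×ℂ Icc (z.im - δ) (z.im + δ),
      (s₀, w) ∈ D :=
    fun z hz w hw => hδO z hz (closedSquare_subset_closedBall_two_mul hw)
  have hKM : ∀ z ∈ Z₀, ∀ w ∈ Icc (z.re - δ) (z.re + δ) ×ℂ Icc (z.im - δ) (z.im + δ), ‖w‖ < M := by
    intro z hz w hw
    have h1 : dist w z ≤ 2 * δ := closedSquare_subset_closedBall_two_mul hw
    rw [dist_eq_norm] at h1
    linarith [norm_sub_norm_le w z, hZM z hz]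
  have huniq : ∀ z ∈ Z₀, ∀ w ∈ closedBall z (2 * δ), w ∈ Z₀ → w = z := by
    intro z hz w hw hwZ
    by_contra hne
    have := hδsep z hz w hwZ hne
    rw [mem_closedBall] at hw
    linarith
  have hbd₀ : ∀ z ∈ Z₀, ∀ w ∈ Icc (z.re - δ) (z.re + δ) ×ℂ Icc (z.im - δ) (z.im + δ),
      w ∉ Ioo (z.re - δ) (z.re + δ) ×ℂ Ioo (z.im - δ) (z.im + δ) → f s₀ w ≠ 0 := by
    intro z hz w hw hw' hfw
    have hwz : w = z :=
      huniq z hz w (closedSquare_subset_closedBall_two_mul hw) ⟨hKD z hz w hw, hfw⟩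
    exact hw' (hwz ▸ self_mem_openSquare hδ)
  have hdisj : Z₀.PairwiseDisjoint
      fun z => Ioo (z.re - δ) (z.re + δ) ×ℂ Ioo (z.im - δ) (z.im + δ) := by
    intro z hz z' hz' hne
    refine Set.disjoint_left.2 fun w hw hw' => ?_
    have h1 : dist w z ≤ 2 * δ :=
      closedSquare_subset_closedBall_two_mul (Ioo_reProdIm_Ioo_subset_Icc hw)
    have h2 : dist w z' ≤ 2 * δ :=
      closedSquare_subset_closedBall_two_mul (Ioo_reProdIm_Ioo_subset_Icc hw')
    have h3 := hδsep z hz z' hz' (Ne.symm hne)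
    linarith [dist_triangle z' w z, dist_comm w z']
  -- … their union `I` …
  set I : Set ℂ := ⋃ z ∈ Z₀, Ioo (z.re - δ) (z.re + δ) ×ℂ Ioo (z.im - δ) (z.im + δ) with hI_def
  have hIopen : IsOpen I := isOpen_biUnion fun z _ => isOpen_Ioo.reProdIm isOpen_Ioo
  have hIM : ∀ w ∈ I, ‖w‖ < M := by
    intro w hw
    rw [hI_def, mem_iUnion₂] at hw
    obtain ⟨z, hz, hw⟩ := hw
    exact hKM z hz w (Ioo_reProdIm_Ioo_subset_Icc hw)
  have hZ₀I : Z₀ ⊆ I := fun z hz => mem_iUnion₂.2 ⟨z, hz, self_mem_openSquare hδ⟩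
  -- … and the square `[-r, r]²` around the point at infinity
  obtain ⟨r, hr, hrM, hrA, hrB⟩ := exists_halfSide_inftySquare hEs₀ hBs₀ (fun w hw => hw.1) hM
  have hrr : -r < r := by linarith
  -- Step 2: persistence for `s` near `s₀`
  have E1 : ∀ᶠ s in 𝓝 s₀, ∀ z ∈ Z₀,
      ∀ w ∈ Icc (z.re - δ) (z.re + δ) ×ℂ Icc (z.im - δ) (z.im + δ), (s, w) ∈ D :=
    hfin.eventually_all.2 fun z hz =>
      eventually_forall_mem_of_isCompact_isOpen (isCompact_Icc.reProdIm isCompact_Icc) hD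
        (hKD z hz)
  have E2 : ∀ᶠ s in 𝓝 s₀, ∀ w ∈ closedBall (0 : ℂ) r⁻¹ \ I, ¬ ((s, w) ∈ D ∧ f s w = 0) :=
    eventually_forall_notMem_of_isCompact_isClosed ((isCompact_closedBall _ _).diff hIopen) hA
      fun w hw h => hw.2 (hZ₀I h)
  have E3 : ∀ᶠ s in 𝓝 s₀, ∀ z ∈ Z₀,
      (∀ w ∈ Icc (z.re - δ) (z.re + δ) ×ℂ Icc (z.im - δ) (z.im + δ),
        w ∉ Ioo (z.re - δ) (z.re + δ) ×ℂ Ioo (z.im - δ) (z.im + δ) → f s w ≠ 0) ∧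
      ∑ᶠ ρ ∈ {ρ : ℂ | f s ρ = 0 ∧ ρ ∈ Ioo (z.re - δ) (z.re + δ) ×ℂ Ioo (z.im - δ) (z.im + δ)},
          (meromorphicOrderAt (f s) ρ).untop₀ =
        ∑ᶠ ρ ∈ {ρ : ℂ | f s₀ ρ = 0 ∧ ρ ∈ Ioo (z.re - δ) (z.re + δ) ×ℂ Ioo (z.im - δ) (z.im + δ)},
          (meromorphicOrderAt (f s₀) ρ).untop₀ :=
    hfin.eventually_all.2 fun z hz =>
      zeroCountStable_nhds (by linarith) (by linarith)
        (eventually_forall_mem_of_isCompact_isOpen (isCompact_Icc.reProdIm isCompact_Icc) hD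
          (hKD z hz))
        hfa hfc hfd (hbd₀ z hz)
  have hQ_of : ∀ s : S, (∀ w ∈ closedBall (0 : ℂ) r⁻¹ \ I, ¬ ((s, w) ∈ D ∧ f s w = 0)) →
      ∀ w : ℂ, ‖w‖ ≤ r⁻¹ → w ∉ I → ¬ ((s, w) ∈ D ∧ f s w = 0) :=
    fun s h w hw hwI => h w ⟨mem_closedBall_zero_iff.2 hw, hwI⟩
  -- the sum of the zero counts of `f s` in the open squares is eventually constant
  have hsum : ∀ᶠ s in 𝓝 s₀, (∑ᶠ z ∈ Z₀, ∑ᶠ w ∈ {w : ℂ | f s w = 0 ∧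
        w ∈ Ioo (z.re - δ) (z.re + δ) ×ℂ Ioo (z.im - δ) (z.im + δ)},
        (meromorphicOrderAt (f s) w).untop₀) =
      ∑ᶠ z ∈ Z₀, ∑ᶠ w ∈ {w : ℂ | f s₀ w = 0 ∧
        w ∈ Ioo (z.re - δ) (z.re + δ) ×ℂ Ioo (z.im - δ) (z.im + δ)},
        (meromorphicOrderAt (f s₀) w).untop₀ :=
    E3.mono fun s h3 => finsum_mem_congr rfl fun z hz => (h3 z hz).2
  by_cases h0 : (s₀, (0 : ℂ)) ∈ E ∧ g s₀ 0 = 0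
  · -- Case A: the point at infinity of the sphere at `s₀` lies on the divisor
    have hKE : ∀ w ∈ Icc (-r) r ×ℂ Icc (-r) r, (s₀, w) ∈ E :=
      fun w hw => hrA h0 (closedSquare_zero_subset_closedBall hw)
    have hbdE : ∀ w ∈ Icc (-r) r ×ℂ Icc (-r) r, w ∉ Ioo (-r) r ×ℂ Ioo (-r) r → g s₀ w ≠ 0 := by
      intro w hw hw' hgw
      have hw0 : w ≠ 0 := fun h => hw' (h ▸ zero_mem_openSquare hr)
      have h2r : ‖w‖ ≤ 2 * r := by
        have := closedSquare_zero_subset_closedBall hw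
        rwa [mem_closedBall, dist_zero_right] at this
      have hlt := lt_norm_inv_of_norm_le_two_mul hM hrM h2r hw0
      have hwZ : w⁻¹ ∈ Z₀ :=
        ⟨(hED s₀ w hw0).1 (hKE w hw), by rw [← hgf s₀ w hw0]; exact hgw⟩
      linarith [hIM _ (hZ₀I hwZ)]
    have E4 : ∀ᶠ s in 𝓝 s₀, ∀ w ∈ Icc (-r) r ×ℂ Icc (-r) r, (s, w) ∈ E :=
      eventually_forall_mem_of_isCompact_isOpen (isCompact_Icc.reProdIm isCompact_Icc) hE hKE
    have E5 := zeroCountStable_nhds (F := g) hrr hrr E4 hga hgc hgd hbdE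
    -- Step 3: the count at a good parameter
    have EV : ∀ᶠ s in 𝓝 s₀,
        (∑ᶠ z ∈ {z : ℂ | (s, z) ∈ D ∧ f s z = 0}, (meromorphicOrderAt (f s) z).untop₀) +
          (∑ᶠ w ∈ {w : ℂ | w = 0 ∧ (s, w) ∈ E ∧ g s w = 0},
            (meromorphicOrderAt (g s) w).untop₀) =
        (∑ᶠ z ∈ Z₀, ∑ᶠ w ∈ {w : ℂ | f s w = 0 ∧
            w ∈ Ioo (z.re - δ) (z.re + δ) ×ℂ Ioo (z.im - δ) (z.im + δ)},
            (meromorphicOrderAt (f s) w).untop₀) +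
          ∑ᶠ w ∈ {w : ℂ | g s w = 0 ∧ w ∈ Set.Ioo (-r) r ×ℂ Set.Ioo (-r) r},
            (meromorphicOrderAt (g s) w).untop₀ := by
      refine (E1.and (E2.and (E3.and (E4.and E5)))).mono fun s hs => ?_
      obtain ⟨h1, h2, h3, h4, h5⟩ := hs
      obtain ⟨hfarfin, hfar⟩ := helper_twoChartFarZeroCount S f g D E s I r M hr hM hrM (hED s)
        (hgf s) (fun w hw => hfa (s, w) hw) (fun w hw => hga (s, w) hw) hIM h4 h5.1 (hQ_of s h2)
      obtain ⟨-, hnear⟩ := zeroCount_near_decomp hfin hδ h1 (fun w hw => hfa (s, w) hw)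
        (fun z hz => (h3 z hz).1) hdisj hfarfin
      rw [hnear, add_assoc, hfar]
    refine (EV.and (hsum.and E5)).mono fun s hs => ?_
    obtain ⟨hs, hs', h5⟩ := hs
    rw [hs, EV.self_of_nhds, h5.2, hs']
  · -- Case B: the point at infinity of the sphere at `s₀` is off the divisor
    have hKE : ∀ w ∈ Icc (-r) r ×ℂ Icc (-r) r, ¬ ((s₀, w) ∈ E ∧ g s₀ w = 0) :=
      fun w hw => hrB h0 w (closedSquare_zero_subset_closedBall hw)
    have E4 : ∀ᶠ s in 𝓝 s₀, ∀ w ∈ Icc (-r) r ×ℂ Icc (-r) r, ¬ ((s, w) ∈ E ∧ g s w = 0) :=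
      eventually_forall_notMem_of_isCompact_isClosed (isCompact_Icc.reProdIm isCompact_Icc) hB
        hKE
    have EV : ∀ᶠ s in 𝓝 s₀,
        (∑ᶠ z ∈ {z : ℂ | (s, z) ∈ D ∧ f s z = 0}, (meromorphicOrderAt (f s) z).untop₀) +
          (∑ᶠ w ∈ {w : ℂ | w = 0 ∧ (s, w) ∈ E ∧ g s w = 0},
            (meromorphicOrderAt (g s) w).untop₀) =
        ∑ᶠ z ∈ Z₀, ∑ᶠ w ∈ {w : ℂ | f s w = 0 ∧
            w ∈ Ioo (z.re - δ) (z.re + δ) ×ℂ Ioo (z.im - δ) (z.im + δ)},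
            (meromorphicOrderAt (f s) w).untop₀ := by
      refine (E1.and (E2.and (E3.and E4))).mono fun s hs => ?_
      obtain ⟨h1, h2, h3, h4⟩ := hs
      obtain ⟨hfar, hB0⟩ := zeroCount_far_decomp_off hr (hED s) (hgf s) h4 (hQ_of s h2)
      obtain ⟨-, hnear⟩ := zeroCount_near_decomp hfin hδ h1 (fun w hw => hfa (s, w) hw)
        (fun z hz => (h3 z hz).1) hdisj (by rw [hfar]; exact finite_empty)
      rw [hnear, hfar, hB0, finsum_mem_empty, finsum_mem_empty, add_zero, add_zero]
    refine (EV.and hsum).mono fun s hs => ?_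
    rw [hs.1, EV.self_of_nhds, hs.2]

/-- **The intersection count of a continuous family of two-chart `JX`-spheres with a sphere at
infinity is locally constant.**  Let `X` be a `C^∞` real `4`-manifold with tangent endomorphisms
`JX`, `U ⊆ X` open, `T` a `C^∞` `JX`-holomorphic function on `U` whose zero locus
`H∞ = {y ∈ U | T y = 0}` is closed in `X`, and let `(u s, v s)_{s ∈ S}` be a family of
`JX`-holomorphic two-chart spheres (`v s w = u s w⁻¹` for `w ≠ 0`), jointly continuous in `(s, z)`
together with the complex derivatives of the chart expressions `T ∘ u s`, `T ∘ v s` (where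
defined).  If the sphere at `s₀` meets `H∞` in finitely many chart parameters `z ∈ ℂ`, then for
all `s` near `s₀` the intersection number
`N(s) = Σ_{u s z ∈ H∞} ord_z (T ∘ u s) + [ord_0 (T ∘ v s) if v s 0 ∈ H∞]` equals `N(s₀)`.
Proof: `T ∘ u s`, `T ∘ v s` are holomorphic on the open preimages of `U`
(`helper_holCoordCompJHol`), so this is the abstract two-chart count stability
`twoChart_zeroCount_eventually_eq`.  (The hypothesis that the sphere at `s₀` is not contained in
`H∞` follows from the finiteness hypothesis and is not used.)
[cite: McDuffSalamon2012, §2.6 and Appendix E (local intersection numbers of `J`-holomorphic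
curves and their deformation invariance)] -/
theorem helper_sphereWedgeCountStable : ∀ (X : Type) [TopologicalSpace X] [ChartedSpace (EuclideanSpace ℝ (Fin 4)) X] [IsManifold (𝓡 4) ∞ X] (JX : ∀ y : X, TangentSpace (𝓡 4) y →L[ℝ] TangentSpace (𝓡 4) y) (T : X → ℂ) (U : Set X) (S : Type) [TopologicalSpace S] (u v : S → ℂ → X) (s₀ : S), IsOpen U → ContMDiffOn (𝓡 4) 𝓘(ℝ, ℂ) ∞ T U → (∀ y ∈ U, ∀ w : TangentSpace (𝓡 4) y, (show ℂ from mfderiv (𝓡 4) 𝓘(ℝ, ℂ) T y (JX y w)) = Complex.I * (show ℂ from mfderiv (𝓡 4) 𝓘(ℝ, ℂ) T y w)) → IsClosed {y : X | y ∈ U ∧ T y = 0} → (∀ s : S, ContMDiff 𝓘(ℝ, ℂ) (𝓡 4) ∞ (u s)) → (∀ s : S, ContMDiff 𝓘(ℝ, ℂ) (𝓡 4) ∞ (v s)) → (∀ (s : S) (z : ℂ), z ≠ 0 → v s z = u s z⁻¹) → (∀ s : S, Literature.Geometry.Symplectic.IsJHolomorphic (𝓡 4) JX (u s)) → (∀ s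 : S, Literature.Geometry.Symplectic.IsJHolomorphic (𝓡 4) JX (v s)) → Continuous (fun q : S × ℂ => u q.1 q.2) → Continuous (fun q : S × ℂ => v q.1 q.2) → ContinuousOn (fun q : S × ℂ => deriv (T ∘ u q.1) q.2) {q : S × ℂ | u q.1 q.2 ∈ U} → ContinuousOn (fun q : S × ℂ => deriv (T ∘ v q.1) q.2) {q : S × ℂ | v q.1 q.2 ∈ U} → {z : ℂ | u s₀ z ∈ U ∧ T (u s₀ z) = 0}.Finite → (∃ z : ℂ, ¬ (u s₀ z ∈ U ∧ T (u s₀ z) = 0)) → ∀ᶠ s in nhds s₀, (∑ᶠ z ∈ {z : ℂ | u s z ∈ U ∧ T (u s z) = 0}, (meromorphicOrderAt (T ∘ u s) z).untop₀) + (∑ᶠ w ∈ {w : ℂ | w = 0 ∧ v s w ∈ U ∧ T (v s w) = 0}, (meromorphicOrderAt (T ∘ v s) w).untop₀) = (∑ᶠ z ∈ {z : ℂ | u s₀ z ∈ U ∧ T (u s₀ z) = 0}, (meromorphicOrderAt (T ∘ u s₀) z).untop₀) + (∑ᶠ w ∈ {w : ℂ | w = 0 ∧ v s₀ w ∈ U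 ∧ T (v s₀ w) = 0}, (meromorphicOrderAt (T ∘ v s₀) w).untop₀) := by
  intro X _ _ _ JX T U S _ u v s₀ hU hT hTJ hH hu hv hvu hJu hJv huc hvc hud hvd hfin _
  -- holomorphy of the two chart expressions `T ∘ u s`, `T ∘ v s` on the open preimages of `U`
  have hfa : ∀ q ∈ {q : S × ℂ | u q.1 q.2 ∈ U}, AnalyticAt ℂ ((fun s => T ∘ u s) q.1) q.2 :=
    fun q hq => (helper_holCoordCompJHol X JX T U (u q.1) hU hT hTJ (hu q.1) (hJu q.1)).analyticAt
      ((hU.preimage (hu q.1).continuous).mem_nhds hq)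
  have hga : ∀ q ∈ {q : S × ℂ | v q.1 q.2 ∈ U}, AnalyticAt ℂ ((fun s => T ∘ v s) q.1) q.2 :=
    fun q hq => (helper_holCoordCompJHol X JX T U (v q.1) hU hT hTJ (hv q.1) (hJv q.1)).analyticAt
      ((hU.preimage (hv q.1).continuous).mem_nhds hq)
  -- joint continuity of the chart expressions
  have hfc :
      ContinuousOn (fun q : S × ℂ => (fun s => T ∘ u s) q.1 q.2) {q : S × ℂ | u q.1 q.2 ∈ U} :=
    hT.continuousOn.comp huc.continuousOn fun q hq => hq
  have hgc :
      ContinuousOn (fun q : S × ℂ => (fun s => T ∘ v s) q.1 q.2) {q : S × ℂ | v q.1 q.2 ∈ U} :=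
    hT.continuousOn.comp hvc.continuousOn fun q hq => hq
  -- the chart change `w = z⁻¹`
  have hED : ∀ (s : S) (w : ℂ), w ≠ 0 →
      ((s, w) ∈ {q : S × ℂ | v q.1 q.2 ∈ U} ↔ (s, w⁻¹) ∈ {q : S × ℂ | u q.1 q.2 ∈ U}) := by
    intro s w hw
    show v s w ∈ U ↔ u s w⁻¹ ∈ U
    rw [hvu s w hw]
  have hgf : ∀ (s : S) (w : ℂ), w ≠ 0 → (fun s => T ∘ v s) s w = (fun s => T ∘ u s) s w⁻¹ := by
    intro s w hw
    show T (v s w) = T (u s w⁻¹)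
    rw [hvu s w hw]
  exact twoChart_zeroCount_eventually_eq (f := fun s => T ∘ u s) (g := fun s => T ∘ v s)
    (hU.preimage huc) (hU.preimage hvc) (hH.preimage huc) (hH.preimage hvc) hfa hga hfc hgc
    hud hvd hED hgf hfin

end Summit.SmoothPoincare4.SmoothPoincare4.Theorems.GromovRecognitionRelEnd.CrossCapLaurent

end
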